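import Literature.IUT.HodgeTheaters.InitialThetaData
import Literature.NumberTheory.EllipticCurves.GaloisAction
import Literature.NumberTheory.EllipticCurves.VariableChangePointsMap
import Mathlib.FieldTheory.Galois.Infinite
import Mathlib.FieldTheory.KrullTopology
import HarnessLib

/-!
# [IUTchI] Def. 3.1 (b)(c): the `2`- and `l`-torsion of `E_K := E_F ⊗ K` are fixed pointwise by `G_K`
# (the convention bridge from `InitialThetaData` to the tree's `geomTorsion` / `absoluteGaloisGroup`)

`Proofs` file (theorems only; no definition, no named fact, no instance) of the cell `abc-iut`
(wave-5 prover abc-iut-w5-d158; support for the K-level valuation clause of [IUTchI] Ex. 3.2 (iv),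
`Literature/NumberTheory/EllipticCurves/MultiplicativeReductionBaseChangeTorsionProofs.lean`, whose
hypotheses `hfix2` / `hfixl` are exactly the conclusions below).  S. Mochizuki, *Inter-universal
Teichmüller theory I*, Def. 3.1, kurims manuscript (May 2020) pp. 61–62: (b) "the `2·3`-torsion points
of `E_F` are rational over `F`", (c) "`K ⊆ F̄` … the finite Galois extension of `F` determined by the
kernel of [`G_F → GL₂(𝔽_l)`]" — typed by abc-iut-L5-t2 as the fields `torsion_six_rational` and
`range_K_iff` of `InitialThetaData F K Fbar E l P` over an ABSTRACT algebraic closure `Fbar` of `F` with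
`F → K → Fbar`.  The tree's elliptic-curve library speaks of `WeierstrassCurve.geomTorsion W n` (the
`n`-torsion of `W` over `AlgebraicClosure K`) with its action of `Field.absoluteGaloisGroup K`.  This
file proves, by Galois theory and transport of structure only:

* `fixesTorsion_of_forall_algebraMap_eq` — for `F → K → F̄` (`F̄` an algebraic closure of `F`,
  `char F = 0`) and a curve `E/F` whose `l`-torsion cuts out `K` in the sense of `range_K_iff`
  (`K = F̄^{H}`, `H = {σ ∈ G_F | σ` fixes `E[l](F̄)` pointwise`}`): EVERY `σ ∈ G_F` fixing `K` pointwise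
  fixes `E[l](F̄)` pointwise — i.e. `Gal(F̄/K) ⊆ H`, the non-trivial inclusion of `Gal(F̄/F̄^H) = H`,
  which needs `H` CLOSED in the Krull topology (it is an intersection of point stabilisers, each of
  which contains the open subgroup `Gal(F̄/F(x_P, y_P))`) and the Galois correspondence for closed
  subgroups (Mathlib `InfiniteGalois.fixingSubgroup_fixedField`).
* `forall_smul_geomTorsion_baseChange_eq_of_range_K_iff` — hence `G_K = Gal(K̄/K)` fixes
  `E_K[l](K̄)` pointwise (`K̄ := AlgebraicClosure K`, identified with `F̄` over `K` by
  `IsAlgClosure.equiv`; points transported along `Affine.Point.map` and `Affine.Point.congrEquiv`).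
* `forall_smul_geomTorsion_baseChange_eq_of_torsion_rational` — if every `F̄`-point of `E` killed by
  `n` is `F`-rational, then `G_K` fixes `E_K[n](K̄)` pointwise.
* For an initial Θ-datum `D : InitialThetaData F K Fbar E l P`:
  **`InitialThetaData.forall_smul_geomTorsion_baseChange_l`** (from `range_K_iff`) and
  **`InitialThetaData.forall_smul_geomTorsion_baseChange_two`** (from `torsion_six_rational`).

Classical (Silverman *AEC* VIII.§1; infinite Galois theory, e.g. Milne *Fields and Galois Theory*
Thm. 7.12); nothing of [IUTchI–IV] is asserted; no side is taken on [IUTchIII] Cor. 3.12.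
-/

noncomputable section

open scoped Classical

universe u

namespace Literature.IUT.HodgeTheaters

open WeierstrassCurve Literature.NumberTheory.EllipticCurves Literature.NumberTheory.GaloisRepresentations

section Abstract

variable {F : Type u} [Field F] [CharZero F] {K : Type u} [Field K] [Algebra F K]
  {Fbar : Type u} [Field Fbar] [Algebra F Fbar] [Algebra K Fbar] [IsScalarTower F K Fbar]
  [IsAlgClosure F Fbar] (E : WeierstrassCurve F)

omit [CharZero F] [Algebra K Fbar] [IsScalarTower F K Fbar] [IsAlgClosure F Fbar] in
/-- L5's `galoisAct E σ P` is the tree's Galois action `σ • P` on `E(F̄) = (E ⊗ F̄).Point`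
(both are Mathlib's `Affine.Point.map σ`). [folklore] -/
private theorem galoisAct_eq_smul (σ : Fbar ≃ₐ[F] Fbar) (P : GeomPoints Fbar E) :
    galoisAct E σ P = σ • (P : (E.baseChange Fbar).toAffine.Point) := rfl

omit [CharZero F] [Algebra K Fbar] [IsScalarTower F K Fbar] in
/-- The stabiliser in `G_F = Aut(F̄/F)` of a point of `E(F̄)` is OPEN for the Krull topology: it contains
`Gal(F̄/F(x_P, y_P))`, and `F(x_P, y_P)/F` is finite (`F̄/F` algebraic). Silverman *AEC* VIII.§1;
Serre, *Galois Cohomology* II.§1 (discrete Galois modules). [cite: SilvermanAEC2009, VIII.§1] -/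
theorem isOpen_stabilizer_geomPoint (P : GeomPoints Fbar E) :
    IsOpen ((MulAction.stabilizer (Fbar ≃ₐ[F] Fbar) (P : (E.baseChange Fbar).toAffine.Point) :
      Subgroup (Fbar ≃ₐ[F] Fbar)) : Set (Fbar ≃ₐ[F] Fbar)) := by
  haveI : Algebra.IsAlgebraic F Fbar := IsAlgClosure.isAlgebraic
  rcases P with _ | ⟨x, y, hxy⟩
  · -- the stabiliser of `O` is everything
    have htop : (MulAction.stabilizer (Fbar ≃ₐ[F] Fbar)
        ((0 : (E.baseChange Fbar).toAffine.Point)) : Subgroup (Fbar ≃ₐ[F] Fbar)) = ⊤ := by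
      ext σ
      simp only [MulAction.mem_stabilizer_iff, smul_zero, Subgroup.mem_top]
    rw [show (Affine.Point.zero : (E.baseChange Fbar).toAffine.Point) = 0 from rfl, htop]
    exact isOpen_univ
  · -- the stabiliser of `(x, y)` contains `Gal(F̄/F(x, y))`, which is open
    have hfd : FiniteDimensional F (IntermediateField.adjoin F ({x, y} : Set Fbar)) :=
      IntermediateField.finiteDimensional_adjoin fun z _ => (Algebra.IsAlgebraic.isAlgebraic z).isIntegral
    refine Subgroup.isOpen_mono (H₁ := (IntermediateField.adjoin F ({x, y} : Set Fbar)).fixingSubgroup)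
      ?_ (IntermediateField.fixingSubgroup_isOpen _)
    intro σ hσ
    rw [IntermediateField.mem_fixingSubgroup_iff] at hσ
    have hx : σ x = x := hσ x (IntermediateField.subset_adjoin F _ (by simp))
    have hy : σ y = y := hσ y (IntermediateField.subset_adjoin F _ (by simp))
    rw [MulAction.mem_stabilizer_iff]
    change Affine.Point.map (σ : Fbar →ₐ[F] Fbar) (Affine.Point.some x y hxy) = Affine.Point.some x y hxy
    rw [Affine.Point.map_some]
    exact Affine.Point.some.congr_simp _ _ hx _ _ hy _

omit [Algebra F K] [IsScalarTower F K Fbar] in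
/-- **`Gal(F̄/K) ⊆ Ker(G_F → Aut E[l](F̄))` when `K` is cut out by the `l`-torsion** ([IUTchI] Def. 3.1 (c)
`range_K_iff`: `K = F̄^H`, `H` the pointwise stabiliser of `E[l](F̄)`): every `σ ∈ G_F` fixing `K`
pointwise fixes every `l`-torsion point.  Proof: `H` is closed (intersection of open point stabilisers),
so `Gal(F̄/F̄^H) = H` by the Galois correspondence for closed subgroups (`F̄/F` is Galois in
characteristic `0`). [cite: Mochizuki2012, IUTchI Def. 3.1 (c) p.62] -/
theorem fixesTorsion_of_forall_algebraMap_eq {l : ℕ}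
    (hK : ∀ x : Fbar, x ∈ Set.range (algebraMap K Fbar) ↔
      ∀ σ : Fbar ≃ₐ[F] Fbar, FixesTorsion E l σ → σ x = x)
    (σ : Fbar ≃ₐ[F] Fbar) (hσ : ∀ k : K, σ (algebraMap K Fbar k) = algebraMap K Fbar k) :
    FixesTorsion E l σ := by
  haveI : Algebra.IsAlgebraic F Fbar := IsAlgClosure.isAlgebraic
  haveI : IsGalois F Fbar := {}
  -- `H` := the pointwise stabiliser of the `l`-torsion, as an intersection of stabilisers
  let T : Type u := {P : GeomPoints Fbar E // (l : ℤ) • P = 0}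
  let H : Subgroup (Fbar ≃ₐ[F] Fbar) :=
    ⨅ P : T, MulAction.stabilizer (Fbar ≃ₐ[F] Fbar) (P.1 : (E.baseChange Fbar).toAffine.Point)
  have hmem : ∀ τ : Fbar ≃ₐ[F] Fbar, τ ∈ H ↔ FixesTorsion E l τ := by
    intro τ
    simp only [H, Subgroup.mem_iInf, MulAction.mem_stabilizer_iff]
    constructor
    · intro h P hP
      rw [galoisAct_eq_smul]
      exact h ⟨P, hP⟩
    · intro h P
      have := h P.1 P.2
      rwa [galoisAct_eq_smul] at this
  -- `H` is closed
  have hclosed : IsClosed (H : Set (Fbar ≃ₐ[F] Fbar)) := by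
    have hset : (H : Set (Fbar ≃ₐ[F] Fbar)) =
        ⋂ P : T, ((MulAction.stabilizer (Fbar ≃ₐ[F] Fbar) (P.1 : (E.baseChange Fbar).toAffine.Point) :
          Subgroup (Fbar ≃ₐ[F] Fbar)) : Set (Fbar ≃ₐ[F] Fbar)) := by
      ext τ
      simp only [H, SetLike.mem_coe, Subgroup.mem_iInf, Set.mem_iInter]
    rw [hset]
    exact isClosed_iInter fun P =>
      Subgroup.isClosed_of_isOpen _ (isOpen_stabilizer_geomPoint E P.1)
  let Hc : ClosedSubgroup (Fbar ≃ₐ[F] Fbar) := ⟨H, hclosed⟩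
  -- `σ` fixes `F̄^H = K` pointwise
  have hfix : σ ∈ (IntermediateField.fixedField (Hc : Subgroup (Fbar ≃ₐ[F] Fbar))).fixingSubgroup := by
    rw [IntermediateField.mem_fixingSubgroup_iff]
    intro x hx
    rw [IntermediateField.mem_fixedField_iff] at hx
    have hxK : x ∈ Set.range (algebraMap K Fbar) :=
      (hK x).mpr fun τ hτ => hx τ ((hmem τ).mpr hτ)
    obtain ⟨k, rfl⟩ := hxK
    exact hσ k
  rw [InfiniteGalois.fixingSubgroup_fixedField Hc] at hfix
  exact (hmem σ).mp hfix

omit [CharZero F] [IsAlgClosure F Fbar] in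
/-- `(E ⊗ K) ⊗ F̄ = E ⊗ F̄` along the tower `F → K → F̄`. [folklore] -/
private theorem baseChange_baseChange_eq : (E.baseChange K).baseChange Fbar = E.baseChange Fbar := by
  simp only [WeierstrassCurve.baseChange, WeierstrassCurve.map_map, ← IsScalarTower.algebraMap_eq]

omit [CharZero F] [IsAlgClosure F Fbar] in
/-- **Transport along `ι : K̄ ≃ₐ[K] F̄`.** For `τ ∈ G_K = Aut(K̄/K)` let `σ := ι ∘ τ ∘ ι⁻¹ ∈ Aut(F̄/F)`;
if `σ` fixes the transported point `ι_* Q ∈ E(F̄)` of a point `Q ∈ E_K(K̄)`, then `τ` fixes `Q`.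
(Silverman *AEC* VIII.§1; Serre, *Galois Cohomology* I.§2.4, compatible pairs.) [folklore] -/
private theorem smul_eq_of_map_fixed (ι : AlgebraicClosure K ≃ₐ[K] Fbar) (τ : Field.absoluteGaloisGroup K)
    (Q : ((E.baseChange K).toAffine.baseChange (AlgebraicClosure K)).Point)
    (hfix : Affine.Point.map (((ι.symm.trans ((Field.absoluteGaloisGroup.toAlgEquiv K τ).trans ι)).restrictScalars F :
        Fbar ≃ₐ[F] Fbar) : Fbar →ₐ[F] Fbar)
      (Affine.Point.congrEquiv (baseChange_baseChange_eq (K := K) (Fbar := Fbar) E)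
        (Affine.Point.map (W' := (E.baseChange K).toAffine) (ι : AlgebraicClosure K →ₐ[K] Fbar) Q)) =
      Affine.Point.congrEquiv (baseChange_baseChange_eq (K := K) (Fbar := Fbar) E)
        (Affine.Point.map (W' := (E.baseChange K).toAffine) (ι : AlgebraicClosure K →ₐ[K] Fbar) Q)) :
    (Field.absoluteGaloisGroup.toAlgEquiv K τ : AlgebraicClosure K ≃ₐ[K] AlgebraicClosure K) • Q = Q := by
  rcases Q with _ | ⟨x, y, hxy⟩
  · exact smul_zero _
  · change Affine.Point.map (W' := (E.baseChange K).toAffine)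
        ((Field.absoluteGaloisGroup.toAlgEquiv K τ : AlgebraicClosure K ≃ₐ[K] AlgebraicClosure K) :
          AlgebraicClosure K →ₐ[K] AlgebraicClosure K) (Affine.Point.some x y hxy) = Affine.Point.some x y hxy
    simp only [Affine.Point.map_some, Affine.Point.congrEquiv_some, Affine.Point.some.injEq] at hfix
    obtain ⟨hx, hy⟩ := hfix
    have hx' : ι (Field.absoluteGaloisGroup.toAlgEquiv K τ (ι.symm (ι x))) = ι x := hx
    have hy' : ι (Field.absoluteGaloisGroup.toAlgEquiv K τ (ι.symm (ι y))) = ι y := hy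
    rw [ι.symm_apply_apply] at hx' hy'
    rw [Affine.Point.map_some]
    exact Affine.Point.some.congr_simp _ _ (ι.injective hx') _ _ (ι.injective hy') _

/-- **`G_K` fixes `E_K[l](K̄)` pointwise when `K` is cut out by `E[l]`** ([IUTchI] Def. 3.1 (c), the
field `range_K_iff`), in the tree's vocabulary (`Field.absoluteGaloisGroup K` acting on
`geomTorsion (E ⊗ K) l`). [cite: Mochizuki2012, IUTchI Def. 3.1 (c) p.62] -/
theorem forall_smul_geomTorsion_baseChange_eq_of_range_K_iff {l : ℕ}
    (hK : ∀ x : Fbar, x ∈ Set.range (algebraMap K Fbar) ↔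
      ∀ σ : Fbar ≃ₐ[F] Fbar, FixesTorsion E l σ → σ x = x)
    (τ : Field.absoluteGaloisGroup K) (Q : geomTorsion (E.baseChange K) (l : ℤ)) : τ • Q = Q := by
  haveI : Algebra.IsAlgebraic F Fbar := IsAlgClosure.isAlgebraic
  haveI : IsAlgClosure K Fbar :=
    { isAlgClosed := IsAlgClosure.isAlgClosed F
      isAlgebraic := Algebra.IsAlgebraic.tower_top (K := F) K }
  let ι : AlgebraicClosure K ≃ₐ[K] Fbar := IsAlgClosure.equiv K (AlgebraicClosure K) Fbar
  let σK : Fbar ≃ₐ[K] Fbar := ι.symm.trans ((Field.absoluteGaloisGroup.toAlgEquiv K τ).trans ι)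
  have hσK : ∀ k : K, (σK.restrictScalars F) (algebraMap K Fbar k) = algebraMap K Fbar k :=
    fun k => σK.commutes k
  have hσ : FixesTorsion E l (σK.restrictScalars F) := fixesTorsion_of_forall_algebraMap_eq E hK _ hσK
  -- the point `Q`, at the level of Mathlib's `Point` type, and its transport to `E(F̄)`
  let Q₀ : ((E.baseChange K).toAffine.baseChange (AlgebraicClosure K)).Point := (Q : (E.baseChange K).geomPoints)
  have hQ₀ : (l : ℤ) • Q₀ = 0 := (Submodule.mem_torsionBy_iff (l : ℤ) (Q : (E.baseChange K).geomPoints)).mp Q.2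
  set P : GeomPoints Fbar E := Affine.Point.congrEquiv (baseChange_baseChange_eq (K := K) (Fbar := Fbar) E)
    (Affine.Point.map (W' := (E.baseChange K).toAffine) (ι : AlgebraicClosure K →ₐ[K] Fbar) Q₀) with hP
  have hPl : (l : ℤ) • P = 0 := by
    rw [hP, ← map_zsmul, ← map_zsmul, hQ₀, map_zero, map_zero]
  have hfixP := hσ P hPl
  apply Subtype.ext
  exact smul_eq_of_map_fixed E ι τ Q₀ hfixP

omit [CharZero F] in
/-- **`G_K` fixes `E_K[n](K̄)` pointwise when every `F̄`-point of `E` killed by `n` is `F`-rational**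
([IUTchI] Def. 3.1 (b) "the `2·3`-torsion points of `E_F` are rational over `F`", read for `n ∣ 6`
along `F ⊆ K`): an `F`-rational point is fixed by all of `Aut(F̄/F) ∋ ι ∘ τ ∘ ι⁻¹`.
[cite: Mochizuki2012, IUTchI Def. 3.1 (b) p.62] -/
theorem forall_smul_geomTorsion_baseChange_eq_of_torsion_rational {n : ℤ}
    (hrat : ∀ P : GeomPoints Fbar E, n • P = 0 →
      P ∈ Set.range (WeierstrassCurve.Affine.Point.baseChange (W' := E.toAffine) F Fbar))
    (τ : Field.absoluteGaloisGroup K) (Q : geomTorsion (E.baseChange K) n) : τ • Q = Q := by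
  haveI : Algebra.IsAlgebraic F Fbar := IsAlgClosure.isAlgebraic
  haveI : IsAlgClosure K Fbar :=
    { isAlgClosed := IsAlgClosure.isAlgClosed F
      isAlgebraic := Algebra.IsAlgebraic.tower_top (K := F) K }
  let ι : AlgebraicClosure K ≃ₐ[K] Fbar := IsAlgClosure.equiv K (AlgebraicClosure K) Fbar
  let Q₀ : ((E.baseChange K).toAffine.baseChange (AlgebraicClosure K)).Point := (Q : (E.baseChange K).geomPoints)
  have hQ₀ : n • Q₀ = 0 := (Submodule.mem_torsionBy_iff n (Q : (E.baseChange K).geomPoints)).mp Q.2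
  set P : GeomPoints Fbar E := Affine.Point.congrEquiv (baseChange_baseChange_eq (K := K) (Fbar := Fbar) E)
    (Affine.Point.map (W' := (E.baseChange K).toAffine) (ι : AlgebraicClosure K →ₐ[K] Fbar) Q₀) with hP
  have hPn : n • P = 0 := by
    rw [hP, ← map_zsmul, ← map_zsmul, hQ₀, map_zero, map_zero]
  obtain ⟨R, hR⟩ := hrat P hPn
  apply Subtype.ext
  refine smul_eq_of_map_fixed E ι τ Q₀ ?_
  rw [← hP, ← hR]
  exact Affine.Point.map_baseChange _ R

end Abstract

/-! ## For an initial Θ-datum -/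

namespace InitialThetaData

variable {F : Type u} {K : Type u} {Fbar : Type u} [Field F] [NumberField F] [Field K] [NumberField K]
  [Algebra F K] [Field Fbar] [Algebra F Fbar] [Algebra K Fbar] {E : WeierstrassCurve F} [E.IsElliptic]
  {l : ℕ} {P : BadPlacePredicates K}

/-- **[IUTchI] Def. 3.1 (c) ⟹ `G_K` fixes `E_K[l](K̄)` pointwise** (`K = F(E_F[l])`, the field
`range_K_iff` of the datum), in the tree's `geomTorsion` / `absoluteGaloisGroup` vocabulary — the
hypothesis `hfixl` of `WeierstrassCurve.two_mul_dvd_ordMinimalDiscriminant_baseChange_of_forall_smul_geomTorsion_eq`.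
[cite: Mochizuki2012, IUTchI Def. 3.1 (c) p.62] -/
theorem forall_smul_geomTorsion_baseChange_l (D : InitialThetaData F K Fbar E l P)
    (τ : Field.absoluteGaloisGroup K) (Q : geomTorsion (E.baseChange K) (l : ℤ)) : τ • Q = Q := by
  haveI := D.isAlgClosure
  haveI := D.isScalarTower
  exact forall_smul_geomTorsion_baseChange_eq_of_range_K_iff E D.range_K_iff τ Q

/-- **[IUTchI] Def. 3.1 (b) ⟹ `G_K` fixes `E_K[2](K̄)` pointwise** ("the `2·3`-torsion points of `E_F`
are rational over `F`", the field `torsion_six_rational`; points killed by `2` are killed by `6`) — the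
hypothesis `hfix2` of `WeierstrassCurve.two_mul_dvd_ordMinimalDiscriminant_baseChange_of_forall_smul_geomTorsion_eq`.
[cite: Mochizuki2012, IUTchI Def. 3.1 (b) p.62] -/
theorem forall_smul_geomTorsion_baseChange_two (D : InitialThetaData F K Fbar E l P)
    (τ : Field.absoluteGaloisGroup K) (Q : geomTorsion (E.baseChange K) (2 : ℤ)) : τ • Q = Q := by
  haveI := D.isAlgClosure
  haveI := D.isScalarTower
  refine forall_smul_geomTorsion_baseChange_eq_of_torsion_rational (Fbar := Fbar) E (fun R hR => ?_) τ Q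
  refine D.torsion_six_rational R ?_
  rw [show (6 : ℤ) = 3 * 2 by norm_num, mul_smul, hR, smul_zero]

end InitialThetaData

end Literature.IUT.HodgeTheaters

end
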